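import Mathlib
import Summits.Ventures.PercRepro2.PMK5LocusGZero

/-!
# THE EQUALITY LOCUS OF (HCOV) ON FIVE-VERTEX BASES IS THE LEAD'S FIVE EXACT-ZERO CLASSES — THE KERNEL BASE
CASE OF THEOREM 8.1 (blind cell PercRepro2, mine-2 g25; proofs/MINE2-DEG2.md §24.3; on mine-2 g23's
`PMK5LocusG` / `PMK5LocusGZero` (Theorem 18: `Gc ≡ 0` on a face of `K₅` ⟺ `RuleG`) and the lead's
LEAD-SEP3.md Theorem 8.1 (the five exact-zero classes (SEP-2), (SEP-3) + mirror, (A3-O), (ONE-ROOT) + mirror,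
with the trivial class; its base case (F3) is a check over the 1,024 five-mark graphs))

`K₅` on the five marks `(o, a₁, a₂, a₃, b) = (0, 1, 2, 3, 4)`, an edge set `S` is a bitmask `m < 1024`,
`conn (cfgAvoid m r) x y` = «`x` reaches `y` avoiding `r`» (`K5Kernel.conn`, `PMK5Locus.cfgAvoid`).
The five classes are written out as Booleans on the mask — `Trivial` (`o` or `b` in a rootless component),
`Sep2` (`{a₁,a₂}` separates `o` from `b`), `Sep3` / `Sep3'` (`{a₁,a₃}` resp. `{a₂,a₃}` separates `o` from the
other root and from `b`), `A3O` (`a₃` alone separates `o` from both roots), `OneRoot` / `OneRoot'` (a root is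
separated by the other root from `o`, `b`, `a₃`) — and their disjunction `FiveClass`.

* **`ruleG_eq_fiveClass`**: `RuleG m = FiveClass m` on every mask (one `decide +kernel` over the 1,024 masks):
  Theorem 18's six-clause rule IS the five-class disjunction on `K₅`.
* **`gc_K5_zero_iff_fiveClass`** / **`gc_K5_pos_iff_fiveClass`**: the two «iff»s of Theorem 18 restated on the
  five classes — `Gc p ends5 0 1 2 3 4 = 0` at every admissible weight vector supported on `m` ⟺ `m` lies in
  one of the five classes; `Gc > 0` at every weight vector interior on `m` ⟺ it lies in none.  This is the
  base case (F3) of Theorem 8.1 in the kernel, both directions, every weight vector.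
* **`fiveClass_count`**: exactly `608` of the `1,024` edge sets lie in the five classes (the lead's `608 / 416`).
Standard axioms.
-/

namespace Summit.Ventures.PercRepro2

open CovForm

namespace K5

namespace PM

/-! ## The five classes as Booleans on the edge mask -/

/-- The trivial class: `o` or `b` lies in a component containing neither root (`σ_o ≡ 0` or `σ_b ≡ 0`). -/
def Trivial (m : ℕ) : Bool :=
  (!conn (cfg m) 0 1 && !conn (cfg m) 0 2) || (!conn (cfg m) 4 1 && !conn (cfg m) 4 2)

/-- (SEP-2): the root pair `{a₁, a₂}` separates `o` from `b`. -/
def Sep2 (m : ℕ) : Bool := !conn (cfgAvoid2 m 1 2) 0 4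

/-- (SEP-3): `{a₁, a₃}` separates `o` from `a₂` and from `b`. -/
def Sep3 (m : ℕ) : Bool := !conn (cfgAvoid2 m 1 3) 0 2 && !conn (cfgAvoid2 m 1 3) 0 4

/-- (SEP-3), the mirror: `{a₂, a₃}` separates `o` from `a₁` and from `b`. -/
def Sep3' (m : ℕ) : Bool := !conn (cfgAvoid2 m 2 3) 0 1 && !conn (cfgAvoid2 m 2 3) 0 4

/-- (A3-O): `a₃` alone separates `o` from both roots. -/
def A3O (m : ℕ) : Bool := !conn (cfgAvoid m 3) 0 1 && !conn (cfgAvoid m 3) 0 2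

/-- (ONE-ROOT): `a₂` separates `a₁` from `o`, `b` and `a₃`. -/
def OneRoot (m : ℕ) : Bool :=
  !conn (cfgAvoid m 2) 1 0 && !conn (cfgAvoid m 2) 1 4 && !conn (cfgAvoid m 2) 1 3

/-- (ONE-ROOT), the mirror: `a₁` separates `a₂` from `o`, `b` and `a₃`. -/
def OneRoot' (m : ℕ) : Bool :=
  !conn (cfgAvoid m 1) 2 0 && !conn (cfgAvoid m 1) 2 4 && !conn (cfgAvoid m 1) 2 3

/-- **The five exact-zero classes of Theorem 8.1 on `K₅`** (the trivial class included). -/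
def FiveClass (m : ℕ) : Bool :=
  Trivial m || Sep2 m || Sep3 m || Sep3' m || A3O m || OneRoot m || OneRoot' m

set_option maxRecDepth 100000 in
/-- **Theorem 18's rule is the five-class disjunction** on every edge set of `K₅`. -/
theorem ruleG_eq_fiveClass : ∀ m : Fin 1024, RuleG m = FiveClass m := by
  decide +kernel

set_option maxRecDepth 100000 in
/-- Exactly `608` of the `1,024` edge sets of `K₅` lie in the five classes. -/
theorem fiveClass_count : ((List.finRange 1024).filter fun m : Fin 1024 => FiveClass m).length = 608 := by
  decide +kernel

/-! ## The two «iff»s of Theorem 18 on the five classes -/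

section Face

variable {R : Type*} [Field R] [LinearOrder R] [IsStrictOrderedRing R]

/-- **THE EQUALITY LOCUS OF (HCOV) ON FIVE-VERTEX BASES IS THE FIVE CLASSES — THE ZERO SIDE**: `Gc = 0` at
every admissible weight vector supported on `m` ⟺ `m` lies in one of the five classes. -/
theorem gc_K5_zero_iff_fiveClass (m : ℕ) (hm : m < 1024) :
    (∀ p : Fin 10 → R, (∀ e : Fin 10, 0 ≤ p e ∧ p e ≤ 1) →
      (∀ e : Fin 10, m.testBit e = false → p e = 0) → Gc p ends5 0 1 2 3 4 = 0) ↔ FiveClass m = true := by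
  rw [gc_K5_zero_iff m hm]
  have h := ruleG_eq_fiveClass ⟨m, hm⟩
  simp only at h
  rw [h]

/-- **THE POSITIVE SIDE**: `Gc > 0` at every weight vector interior on `m` ⟺ `m` lies in none of the five
classes — (HCOV) is strict in the interior of every five-vertex face outside the five classes. -/
theorem gc_K5_pos_iff_fiveClass (m : ℕ) (hm : m < 1024) :
    (∀ p : Fin 10 → R, (∀ e : Fin 10, m.testBit e = true → 0 < p e ∧ p e < 1) →
      (∀ e : Fin 10, m.testBit e = false → p e = 0) → 0 < Gc p ends5 0 1 2 3 4) ↔ FiveClass m = false := by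
  rw [gc_K5_pos_iff m hm]
  have h := ruleG_eq_fiveClass ⟨m, hm⟩
  simp only at h
  rw [h]

end Face

end PM

end K5

end Summit.Ventures.PercRepro2
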